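import Mathlib
import Summits.CriticalPhenomena.SAWScalingLimit.Theorems.SAWDefectDecoherenceDefectDecoherenceSsStarMassHarnackAux2
import HarnessLib

/-!
# The arrival character at a neighbour against the mid-edge mass
(helper stub `ss_norm_arrivalSum_nbr_le` (H3) of the line `sector-slaving`, crux `DefectDecoherence`,
stmt-CriticalPhenomena-8549)

For an adjacent boundary root `a = s(u,w)` (`u ∉ Λ ∋ w`), a vertex `v ∈ Λ` and a neighbour
`t ∈ star Λ v`, the clean twisted arrival sum at `t` is dominated by the `x_c`-mass of the walks to
the mid-edge between `v` and `t`: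
`‖A_ξ(t)‖ ≤ Z(s(v,t)) = ‖F_{x_c,0}(Λ, a, s(v,t))‖ = Σ_{γ : a → s(v,t)} x_c^{ℓ(γ)}`.
Indeed `‖A_ξ(t)‖ ≤ Σ_{s ∼ t} A_s` (unimodular phases, `norm_arrivalSum_le`), `A_s` the mass of the
clean arrivals at `t` through the dart `s → t` (`t` counted).  For `s ≠ v` these, prolonged by `t`,
are exactly the walks `a → s(v,t)` with last vertex `t` (`har_viaT_eq`); for `s = v` they are walks
`a → s(v,t)` with last vertex `v` not through `t` (and `x_c^{ℓ+1} ≤ x_c^ℓ`).  The two families are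
disjoint (`v ≠ t`).  At the root vertex `t = w` there is no clean arrival at all (every walk from
`a` starts at `w`), so the left side vanishes.

Sources: H. Duminil-Copin, S. Smirnov, Ann. of Math. 175 (2012) (arXiv:1007.0575), §1–§2 (walks
between mid-edges); the line card `Lines/sector-slaving.md`.
-/

noncomputable section

open scoped BigOperators ComplexConjugate Classical
open Literature.Probability.LatticeModels Literature.Probability.RandomPlanarGeometry.SAW
open Summit.CriticalPhenomena.SAWScalingLimit.Theorems.DefectDecoherence.TipMartingale

namespace Summit.CriticalPhenomena.SAWScalingLimit.Theorems.DefectDecoherence.SectorSlaving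

variable {Λ : Finset HexVertex} {u w t : HexVertex}

/-- **No clean arrival at the root vertex.**  A walk from `s(u,w)` (`u ∉ Λ`) to a mid-edge
`s(s,t)` of the root vertex `t = w` (`s, t ∈ Λ`) is nontrivial and starts at `w`, so it is never a
clean arrival at `t` through the dart `s → t`. [folklore] -/
theorem nbr_not_clean_at_root {s : HexVertex} (hu : u ∉ Λ) (ht : t ∈ Λ) (hs : s ∈ Λ)
    (hwt : w = t) (γ : HexMidEdgeSAW Λ s(u, w) s(s, t)) :
    ¬ (γ.verts.getLast? = some s ∧ t ∉ γ.verts) := by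
  subst hwt
  rintro ⟨-, h2⟩
  obtain ⟨x, rest, hγ⟩ := List.exists_cons_of_ne_nil (tip_verts_ne_nil hu ht hs γ)
  have hx := γ.head_mem x (by simp [hγ])
  have hxv : x ∈ γ.verts := by simp [hγ]
  rcases Sym2.mem_iff.1 hx with rfl | rfl
  · exact hu (γ.subset _ hxv)
  · exact h2 hxv

/-- **Registered helper `ss_norm_arrivalSum_nbr_le` (H3): the arrival character at a neighbour is
dominated by the mid-edge mass.**  For `u ∉ Λ ∋ w`, `u ∼ w`, `v ∈ Λ` and `t ∈ star Λ v`: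
`‖A_ξ(t)‖ ≤ ‖F_{x_c,0}(Λ, s(u,w), s(v,t))‖ = Σ_{γ : s(u,w) → s(v,t)} x_c^{ℓ(γ)}`. [folklore] -/
theorem ss_norm_arrivalSum_nbr_le :
    ∀ (Λ : Finset HexVertex) (u w v t : HexVertex) (θa ξ : ℝ), u ∉ Λ → w ∈ Λ → hexGraph.Adj u w →
      v ∈ Λ → t ∈ star Λ v →
        ‖arrivalSum Λ s(u, w) θa ξ t‖ ≤ ‖hexParafermionicObservable Λ s(u, w) xc 0 s(v, t)‖ := by
  intro Λ u w v t θa ξ hu _ _ hv ht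
  obtain ⟨htΛ, hvt⟩ := tip_mem_star.1 ht
  have hvstar : v ∈ star Λ t := tip_mem_star.2 ⟨hv, hvt.symm⟩
  refine (norm_arrivalSum_le Λ _ θa ξ t).trans ?_
  rw [har_norm_obs]
  -- the clean arrival masses at `t`, dart by dart (`t` counted)
  set A : HexVertex → ℝ := fun y => ∑ ω : HexMidEdgeSAW Λ s(u, w) s(y, t),
    (if ω.verts.getLast? = some y ∧ t ∉ ω.verts then xc ^ (ω.length + 1) else 0 : ℝ)
  by_cases hwt : w = t
  · -- at the root vertex there is no clean arrival
    have h0 : ∑ s ∈ star Λ t, A s = 0 :=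
      Finset.sum_eq_zero fun s hs => Finset.sum_eq_zero fun γ _ =>
        if_neg (nbr_not_clean_at_root hu htΛ (tip_mem_star.1 hs).1 hwt γ)
    rw [h0]
    exact Finset.sum_nonneg fun γ _ => pow_nonneg xc_pos.le _
  -- `w ≠ t`: the via-`t` walks at `s(v,t)` are the clean arrivals through the other darts
  have hT : (∑ γ : HexMidEdgeSAW Λ s(u, w) s(v, t),
      (if γ.verts.getLast? = some t then xc ^ γ.length else 0)) =
        ∑ s ∈ star Λ t, (if s = v then 0 else A s) := har_viaT_eq hu htΛ hwt hvstar
  have hsplit : ∑ s ∈ star Λ t, A s = A v + ∑ s ∈ star Λ t, (if s = v then 0 else A s) := by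
    have h1 : ∀ s ∈ star Λ t, A s = (if s = v then A s else 0) + (if s = v then 0 else A s) := by
      intro s _
      split_ifs <;> simp
    rw [Finset.sum_congr rfl h1, Finset.sum_add_distrib, Finset.sum_ite_eq_of_mem' _ _ _ hvstar]
  -- the dart `v → t`: clean arrivals are via-`v` walks at `s(v,t)` avoiding `t`
  have hAv : A v ≤ ∑ γ : HexMidEdgeSAW Λ s(u, w) s(v, t),
      (if γ.verts.getLast? = some v ∧ t ∉ γ.verts then xc ^ γ.length else 0) := by
    refine Finset.sum_le_sum fun γ _ => ?_
    split_ifs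
    · rw [pow_succ]
      exact mul_le_of_le_one_right (pow_nonneg xc_pos.le _) hexCriticalFugacity_pos_lt_one.2.le
    · exact le_rfl
  -- assemble: the two families are disjoint events on the walks `s(u,w) → s(v,t)`
  calc ∑ s ∈ star Λ t, A s
      = A v + ∑ γ : HexMidEdgeSAW Λ s(u, w) s(v, t),
          (if γ.verts.getLast? = some t then xc ^ γ.length else 0) := by rw [hsplit, hT]
    _ ≤ (∑ γ : HexMidEdgeSAW Λ s(u, w) s(v, t),
          (if γ.verts.getLast? = some v ∧ t ∉ γ.verts then xc ^ γ.length else 0)) +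
        ∑ γ : HexMidEdgeSAW Λ s(u, w) s(v, t),
          (if γ.verts.getLast? = some t then xc ^ γ.length else 0) := by
      gcongr
    _ = ∑ γ : HexMidEdgeSAW Λ s(u, w) s(v, t),
          ((if γ.verts.getLast? = some v ∧ t ∉ γ.verts then xc ^ γ.length else 0) +
            (if γ.verts.getLast? = some t then xc ^ γ.length else 0)) :=
      Finset.sum_add_distrib.symm
    _ ≤ ∑ γ : HexMidEdgeSAW Λ s(u, w) s(v, t), xc ^ γ.length := by
      refine Finset.sum_le_sum fun γ _ => ?_
      by_cases h1 : γ.verts.getLast? = some v ∧ t ∉ γ.verts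
      · have h2 : ¬ γ.verts.getLast? = some t := fun h2 =>
          hvt.ne (Option.some_injective _ (h1.1.symm.trans h2))
        rw [if_pos h1, if_neg h2, add_zero]
      · rw [if_neg h1, zero_add]
        split_ifs
        · exact le_rfl
        · exact pow_nonneg xc_pos.le _

end Summit.CriticalPhenomena.SAWScalingLimit.Theorems.DefectDecoherence.SectorSlaving

end
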